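import Literature.Geometry.Lorentzian.CarterSuperradiantFarConstants
import Literature.Geometry.Lorentzian.KerrSurfaceGravity
import Mathlib.Analysis.SpecialFunctions.Trigonometric.DerivHyp
import HarnessLib

/-!
# The κ-free numerical depth of the superradiant BF-stable cone kernel bound from `Λ` large, and two
# cone smallness facts
(namespace `Literature.Geometry.Lorentzian.Kerr`; real arithmetic in the threshold cone.)

The deep-barrier kernel bound for Carter's radial equation in the superradiant Breitenlohner–Freedman-stable
sector (`Kerr.superradiant_kernel_le`) consumes the κ-FREE numerical depth
`64(2ω² + B) ≤ k²·exp(4r₊k/5)` (`k = √(θ₁³Λ′/(3584r₊²))`, `Λ′ = Λ − 2amω`, `B` the far constant restarted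
at `ζ = θ₁M/4`) and the smallness `18432 M²σ² ≤ θ₁⁴Λ′`, `|σ| ≤ |ω|` (`σ = ω − mω₊`). In the threshold cone
(`M/2 ≤ |a| ≤ M`, admissible `(ω, m, Λ)`, `0 < m`, `|σ| ≤ ε₀m`):

* `abs_sigma_le_abs_omega_of_cone` — `|σ| ≤ m/(16M) ≤ |ω|` once `ε₀ ≤ 1/(16M)`;
* `sigma_sq_le_of_cone_margin_sharp` — `18432 M²σ² ≤ θ₁⁴Λ′` once `ε₀ ≤ θ₁²/(1088M)`, `0 < θ₁ ≤ 1` and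
  `(1 + θ₁)(2r₊ω)² ≤ Λ′` (as `Kerr.sigma_sq_le_of_cone_margin`, sharper constant);
* `superradiantDepth_of_large` — with the κ-free master variable `Z = 32(1 + M + M⁻¹)⁴(1 + θ₁⁻¹)·Λ`
  (`Kerr.freeMaster_bounds`), `Λ/256 ≤ Λ′`, `ε₀ ≤ 1/(16M)`, `0 < θ₁ ≤ 1`, and `Λ` beyond the threshold of
  `Kerr.exists_forall_mul_pow_le_sinh` for `c = θ₁²/1200`, `C = 64·3670016·(2 + c_B⁗)·A_Z^110`: the
  numerical depth holds (`64(2ω² + B) ≤ 64(2 + c_B⁗)Z^105`, `k² ≥ Z⁻⁵/3670016`,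
  `exp(4r₊k/5) ≥ sinh(θ₁²√Λ/1200)`).

Near-extremal Kerr programme, crux `KappaExplicitWaveDecay`; all proved.

## References
* M. Dafermos, I. Rodnianski, Y. Shlapentokh-Rothman, arXiv:1402.7034 = Ann. of Math. 183 (2016),
  §§6, 8 (key `DafermosRodnianskiShlapentokhrothman2014`). Folklore bookkeeping.
-/

noncomputable section

namespace Literature.Geometry.Lorentzian

namespace Kerr

section Cone

variable {M a ω Λ : ℝ} {m : ℤ}

/-- **`|σ| ≤ m/(16M) ≤ |ω|` in the cone.** For `0 < M`, `M/2 ≤ |a| ≤ M`, `0 < m`, `|ω − mω₊| ≤ ε₀ m`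
with `ε₀ ≤ 1/(16M)`: `|ω − mω₊| ≤ m/(16M)` and `m/(16M) ≤ |ω|`, hence `|ω − mω₊| ≤ |ω|`. [folklore] -/
theorem abs_sigma_le_abs_omega_of_cone (hM : 0 < M) (haM : |a| ≤ M) (ha2 : M / 2 ≤ |a|) (hm : 0 < m)
    {ε₀ : ℝ} (hε₀ : ε₀ ≤ 1 / (16 * M))
    (hcone : |ω - m * horizonAngularVelocity M a| ≤ ε₀ * |(m : ℝ)|) :
    |ω - m * horizonAngularVelocity M a| ≤ m / (16 * M) ∧ (m : ℝ) / (16 * M) ≤ |ω| ∧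
      |ω - m * horizonAngularVelocity M a| ≤ |ω| := by
  obtain ⟨-, -, hσm⟩ := cone_abs_omega_bounds hM haM ha2 hm hε₀ hcone
  have hm1 : (1 : ℝ) ≤ m := by exact_mod_cast hm
  have hmabs : |(m : ℝ)| = m := abs_of_pos (by linarith)
  have hΩ := le_abs_horizonAngularVelocity hM ha2
  have hωlow : (m : ℝ) / (16 * M) ≤ |ω| := by
    have h1 : |(m : ℝ) * horizonAngularVelocity M a| ≥ m * (1 / (8 * M)) := by
      rw [abs_mul, hmabs]; exact mul_le_mul_of_nonneg_left hΩ (by linarith)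
    have h2 : |(m : ℝ) * horizonAngularVelocity M a| - |ω - m * horizonAngularVelocity M a| ≤ |ω| := by
      have := abs_sub_abs_le_abs_sub ((m : ℝ) * horizonAngularVelocity M a) ω
      rw [abs_sub_comm] at this
      linarith
    have e : (m : ℝ) / (16 * M) = m * (1 / (8 * M)) - m / (16 * M) := by field_simp; ring
    rw [e]; linarith
  exact ⟨hσm, hωlow, hσm.trans hωlow⟩

-- adapted from Literature/Geometry/Lorentzian/CarterConeFarCollar.lean (`sigma_sq_le_of_cone_margin`)
/-- **The smallness `18432 M²σ² ≤ θ₁⁴Λ′` in the cone.** For `0 < M`, `M/2 ≤ |a| ≤ M`, `0 < m`,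
`|ω − mω₊| ≤ ε₀ m` with `ε₀ ≤ θ₁²/(1088M)`, `0 < θ₁ ≤ 1`, and the margin `(1 + θ₁)(2r₊ω)² ≤ Λ′`:
`18432 M²σ² ≤ θ₁⁴Λ′` (`|ω| ≥ m/(16M)`, `Λ′ ≥ 4M²ω² ≥ m²/64`, `σ² ≤ ε₀²m²`, `18432·64 ≤ 1088²`). [folklore] -/
theorem sigma_sq_le_of_cone_margin_sharp (hM : 0 < M) (haM : |a| ≤ M) (ha2 : M / 2 ≤ |a|) (hm : 0 < m)
    {ε₀ θ₁ : ℝ} (hθ₁ : 0 < θ₁) (hθ₁1 : θ₁ ≤ 1) (hεθ : ε₀ ≤ θ₁ ^ 2 / (1088 * M))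
    (hcone : |ω - m * horizonAngularVelocity M a| ≤ ε₀ * |(m : ℝ)|)
    (hmargin : (1 + θ₁) * (2 * rPlus M a * ω) ^ 2 ≤ Λ - 2 * a * m * ω) :
    18432 * M ^ 2 * (ω - m * horizonAngularVelocity M a) ^ 2 ≤ θ₁ ^ 4 * (Λ - 2 * a * m * ω) := by
  set σ := ω - m * horizonAngularVelocity M a with hσdef
  set Λ' := Λ - 2 * a * m * ω with hΛ'
  have hm1 : (1 : ℝ) ≤ m := by exact_mod_cast hm
  have hmabs : |(m : ℝ)| = m := abs_of_pos (by linarith)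
  have hrpM : M ≤ rPlus M a := M_le_rPlus M a
  -- `ε₀ ≤ 1/(16M)`, hence `|ω| ≥ m/(16M)`
  have hε16 : ε₀ ≤ 1 / (16 * M) := by
    calc ε₀ ≤ θ₁ ^ 2 / (1088 * M) := hεθ
      _ ≤ 1 / (1088 * M) := by
          apply div_le_div_of_nonneg_right _ (by positivity)
          nlinarith
      _ ≤ 1 / (16 * M) := by
          rw [div_le_div_iff₀ (by positivity) (by positivity)]; nlinarith
  obtain ⟨-, hωlow, -⟩ := abs_sigma_le_abs_omega_of_cone hM haM ha2 hm hε16 hcone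
  rw [hmabs] at hcone
  -- `Λ′ ≥ 4M²ω² ≥ m²/64`
  have hΛ'm : (m : ℝ) ^ 2 / 64 ≤ Λ' := by
    have h1 : 4 * M ^ 2 * ω ^ 2 ≤ Λ' := by
      calc 4 * M ^ 2 * ω ^ 2 ≤ 4 * rPlus M a ^ 2 * ω ^ 2 := by gcongr
        _ = 1 * (2 * rPlus M a * ω) ^ 2 := by ring
        _ ≤ (1 + θ₁) * (2 * rPlus M a * ω) ^ 2 := by gcongr; linarith
        _ ≤ Λ' := hmargin
    have h2 : (m / (16 * M)) ^ 2 ≤ ω ^ 2 := by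
      rw [← sq_abs ω]; exact pow_le_pow_left₀ (by positivity) hωlow 2
    have e : 4 * M ^ 2 * (m / (16 * M)) ^ 2 = (m : ℝ) ^ 2 / 64 := by field_simp; ring
    nlinarith [h2, e]
  -- `σ² ≤ ε₀²m² ≤ θ₁⁴ m²/(1088M)²`
  have hσ2 : σ ^ 2 ≤ (θ₁ ^ 2 / (1088 * M)) ^ 2 * (m : ℝ) ^ 2 := by
    have h1 : |σ| ≤ θ₁ ^ 2 / (1088 * M) * m := hcone.trans (mul_le_mul_of_nonneg_right hεθ (by linarith))
    have h2 : σ ^ 2 ≤ (θ₁ ^ 2 / (1088 * M) * m) ^ 2 := by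
      rw [← sq_abs σ]; exact pow_le_pow_left₀ (abs_nonneg _) h1 2
    calc σ ^ 2 ≤ (θ₁ ^ 2 / (1088 * M) * m) ^ 2 := h2
      _ = (θ₁ ^ 2 / (1088 * M)) ^ 2 * (m : ℝ) ^ 2 := by ring
  calc 18432 * M ^ 2 * σ ^ 2 ≤ 18432 * M ^ 2 * ((θ₁ ^ 2 / (1088 * M)) ^ 2 * (m : ℝ) ^ 2) := by gcongr
    _ = (18432 / 1088 ^ 2) * (θ₁ ^ 4 * (m : ℝ) ^ 2) := by field_simp
    _ ≤ (1 / 64) * (θ₁ ^ 4 * (m : ℝ) ^ 2) := mul_le_mul_of_nonneg_right (by norm_num) (by positivity)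
    _ = θ₁ ^ 4 * ((m : ℝ) ^ 2 / 64) := by ring
    _ ≤ θ₁ ^ 4 * Λ' := mul_le_mul_of_nonneg_left hΛ'm (by positivity)

/-- `sinh y ≤ exp y`. [folklore] -/
private theorem sinh_le_exp (y : ℝ) : Real.sinh y ≤ Real.exp y := by
  rw [Real.sinh_eq]
  have h1 := Real.exp_pos y
  have h2 := Real.exp_pos (-y)
  linarith

set_option maxHeartbeats 400000 in
-- bookkeeping with large literal constants
/-- **The κ-free numerical depth from `Λ` large.** In the cone (`M/2 ≤ |a| ≤ M`, admissible `(ω, m, Λ)`,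
`0 < m`, `|ω − mω₊| ≤ ε₀m`, `ε₀ ≤ 1/(16M)`), with `Λ/256 ≤ Λ′`, `0 < θ₁ ≤ 1`, and
`64·3670016·(2 + c_B⁗)·A_Z^110·Λ^110 ≤ sinh(θ₁²√Λ/1200)` (`A_Z = 32(1 + M + M⁻¹)⁴(1 + θ₁⁻¹)`,
`c_B⁗ = 64·678·(7·10⁴)¹⁶`): `64(2ω² + B) ≤ k²·exp(4r₊k/5)` for `k = √(θ₁³Λ′/(3584r₊²))` and the far constant
`B` at `ζ = θ₁M/4`. [folklore] -/
theorem superradiantDepth_of_large (hM : 0 < M) (haM : |a| ≤ M) (ha : M / 2 ≤ |a|)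
    (hadm : IsAdmissibleTriple a ω m Λ) (hm : 0 < m) {ε₀ θ₁ : ℝ} (hε₀ : ε₀ ≤ 1 / (16 * M))
    (hcone : |ω - m * horizonAngularVelocity M a| ≤ ε₀ * |(m : ℝ)|) (hθ₁ : 0 < θ₁) (hθ₁1 : θ₁ ≤ 1)
    (hΛ' : Λ / 256 ≤ Λ - 2 * a * m * ω)
    (hsinh : 64 * 3670016 * (2 + 64 * 678 * (7e4) ^ 16) * (32 * (1 + M + M⁻¹) ^ 4 * (1 + θ₁⁻¹)) ^ 110 *
        Λ ^ 110 ≤ Real.sinh (θ₁ ^ 2 / 1200 * Real.sqrt Λ))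
    {R B k : ℝ} (hRdef : R = max (7 * M) (max (Real.sqrt (12 * Λ) / |ω|) (1 / (M * ω ^ 2))))
    (hBdef : B = ((ω ^ 2 + 6 * Λ / M ^ 2) / (θ₁ / (100 * M)) ^ 2) ^ 16 *
      Real.exp (2 * (θ₁ / (100 * M)) * (50 * M ^ 2 / (θ₁ * M / 4))) *
      ((θ₁ / (100 * M)) ^ 2 * (2 + 2 * |ω| * R) ^ 2 + 2 * ω ^ 2))
    (hkdef : k = Real.sqrt (θ₁ ^ 3 * (Λ - 2 * a * m * ω) / (3584 * rPlus M a ^ 2))) :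
    64 * (2 * ω ^ 2 + B) ≤ k ^ 2 * Real.exp (4 * rPlus M a * k / 5) := by
  set cB : ℝ := 64 * 678 * (7e4) ^ 16 with hcBdef
  have hcB0 : 0 ≤ cB := by rw [hcBdef]; positivity
  -- the κ-free master variable
  obtain ⟨hZ1, hωZ, hωiZ, hΛZ, hMZ, hMiZ, hM2iZ, hθ₁Z⟩ := freeMaster_bounds hM haM ha hadm hm hε₀ hcone hθ₁
  set Z := 32 * (1 + M + M⁻¹) ^ 4 * (1 + θ₁⁻¹) * Λ with hZdef
  have hZ110 : Z ^ 110 = (32 * (1 + M + M⁻¹) ^ 4 * (1 + θ₁⁻¹)) ^ 110 * Λ ^ 110 := by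
    rw [hZdef, mul_pow]
  rw [mul_assoc (64 * 3670016 * (2 + cB)), ← hZ110] at hsinh
  clear hZ110
  clear_value cB Z
  have hZ0 : 0 < Z := by linarith only [hZ1]
  have hm1 : (1 : ℝ) ≤ m := by exact_mod_cast hm
  have hΛ1 : 1 ≤ Λ := by nlinarith only [hadm.sq_le, hm1]
  have hω0 : 0 < |ω| := by
    have := (cone_abs_omega_le_div hM haM ha hadm hm hε₀ hcone).1
    exact lt_of_lt_of_le (by positivity) this
  set Λ' := Λ - 2 * a * m * ω with hΛ'def
  have hΛ'0 : 0 < Λ' := lt_of_lt_of_le (by positivity) hΛ'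
  set rp := rPlus M a with hrp
  have hrp0 : 0 < rp := rPlus_pos hM a
  have hrp2 : rp ≤ 2 * M := rPlus_le_two_mul_self hM.le a
  -- the left side `≤ 64(2 + c_B) Z^105`
  have hR0 : 0 ≤ R := by rw [hRdef]; exact le_trans (by positivity) (le_max_left _ _)
  have hR : R ≤ 12 * Z ^ 3 := by rw [hRdef]; exact farRadius_le_pow hZ1 hΛ1 hΛZ hMZ hMiZ hω0 hωiZ
  have hB : B ≤ cB * Z ^ 105 := by
    rw [hBdef, hcBdef]
    exact farConstant_B4_le_pow hZ1 hM hθ₁ hθ₁1 hωZ hΛZ (by linarith only [hΛ1]) hM2iZ hθ₁Z hMZ hR0 hR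
  have hω2 : ω ^ 2 ≤ Z ^ 2 := by rw [← sq_abs]; exact pow_le_pow_left₀ (abs_nonneg _) hωZ 2
  have hZ2 : Z ^ 2 ≤ Z ^ 105 := pow_le_pow_right₀ hZ1 (by norm_num)
  have hl : 64 * (2 * ω ^ 2 + B) ≤ 64 * (2 + cB) * Z ^ 105 := by nlinarith only [hB, hω2, hZ2, hcB0]
  -- `k² ≥ Z⁻⁵/3670016`
  have hk2 : k ^ 2 = θ₁ ^ 3 * Λ' / (3584 * rp ^ 2) := by rw [hkdef, Real.sq_sqrt (by positivity)]
  have hk0 : 0 ≤ k := by rw [hkdef]; exact Real.sqrt_nonneg _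
  have hθlow : Z⁻¹ ≤ θ₁ := by rw [inv_le_comm₀ hZ0 hθ₁]; exact hθ₁Z
  have hcoef : (Z ^ 5)⁻¹ / 3670016 ≤ k ^ 2 := by
    rw [hk2, div_le_div_iff₀ (by norm_num) (by positivity)]
    -- `Z⁻⁵ · 3584 rp² ≤ 3670016 θ₁³ Λ′`: `rp² ≤ 4M² ≤ 4Z²`... but we need `M² ≤ Z²` on the LEFT; use
    -- instead `θ₁³ ≥ Z⁻³`, `Λ′ ≥ Λ/256 ≥ 1/256`, and `rp² ≤ 4M²`, `M ≤ Z`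
    have h1 : (Z⁻¹) ^ 3 ≤ θ₁ ^ 3 := pow_le_pow_left₀ (by positivity) hθlow 3
    have h2 : rp ^ 2 ≤ 4 * Z ^ 2 := by
      calc rp ^ 2 ≤ (2 * M) ^ 2 := pow_le_pow_left₀ hrp0.le hrp2 2
        _ = 4 * M ^ 2 := by ring
        _ ≤ 4 * Z ^ 2 := by gcongr
    have h3 : 1 / 256 ≤ Λ' := le_trans (by linarith only [hΛ1]) hΛ'
    -- `(Z⁵)⁻¹ · (3584 rp²) ≤ (Z⁵)⁻¹ · 14336 Z² = 14336 Z⁻³ ≤ 14336 θ₁³ ≤ 3670016 θ₁³ Λ′`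
    have hZ5 : 0 < (Z ^ 5)⁻¹ := by positivity
    calc (Z ^ 5)⁻¹ * (3584 * rp ^ 2) ≤ (Z ^ 5)⁻¹ * (3584 * (4 * Z ^ 2)) := by gcongr
      _ = 14336 * (Z⁻¹) ^ 3 := by field_simp; norm_num
      _ ≤ 14336 * θ₁ ^ 3 := by gcongr
      _ = 14336 * θ₁ ^ 3 * 256 * (1 / 256) := by ring
      _ ≤ 14336 * θ₁ ^ 3 * 256 * Λ' := by gcongr
      _ = θ₁ ^ 3 * Λ' * 3670016 := by ring
  -- `exp(4 rp k/5) ≥ sinh(θ₁²√Λ/1200)`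
  have harg : θ₁ ^ 2 / 1200 * Real.sqrt Λ ≤ 4 * rp * k / 5 := by
    have hs0 : 0 ≤ 4 * rp * k / 5 := by positivity
    have ht0 : 0 ≤ θ₁ ^ 2 / 1200 * Real.sqrt Λ := by positivity
    refine (pow_le_pow_iff_left₀ ht0 hs0 two_ne_zero).1 ?_
    have e1 : (4 * rp * k / 5) ^ 2 = θ₁ ^ 3 * Λ' / 5600 := by
      rw [div_pow, mul_pow, hk2]; field_simp; ring
    have e2 : (θ₁ ^ 2 / 1200 * Real.sqrt Λ) ^ 2 = θ₁ ^ 4 * Λ / 1440000 := by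
      rw [mul_pow, div_pow, Real.sq_sqrt (by linarith only [hΛ1])]; ring
    rw [e1, e2, div_le_div_iff₀ (by norm_num) (by norm_num)]
    have h4 : θ₁ ^ 4 ≤ θ₁ ^ 3 := pow_le_pow_of_le_one hθ₁.le hθ₁1 (by norm_num)
    have h5 : θ₁ ^ 4 * Λ ≤ θ₁ ^ 3 * (256 * Λ') := by
      have : Λ ≤ 256 * Λ' := by linarith only [hΛ']
      exact mul_le_mul h4 this (by linarith only [hΛ1]) (by positivity)
    have h6 : 0 ≤ θ₁ ^ 3 * Λ' := by positivity
    linarith only [h5, h6]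
  have hexp : Real.sinh (θ₁ ^ 2 / 1200 * Real.sqrt Λ) ≤ Real.exp (4 * rp * k / 5) :=
    (Real.sinh_le_sinh.2 harg).trans (sinh_le_exp _)
  have hsinh0 : 0 ≤ Real.sinh (θ₁ ^ 2 / 1200 * Real.sqrt Λ) := Real.sinh_nonneg_iff.2 (by positivity)
  -- combine
  have hr : 64 * (2 + cB) * Z ^ 105 ≤ k ^ 2 * Real.exp (4 * rp * k / 5) := by
    have hZ5 : (Z ^ 5)⁻¹ * Z ^ 5 = 1 := inv_mul_cancel₀ (by positivity)
    have h1 : 64 * (2 + cB) * Z ^ 105 = (Z ^ 5)⁻¹ / 3670016 * (64 * 3670016 * (2 + cB) * Z ^ 110) := by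
      calc 64 * (2 + cB) * Z ^ 105 = 64 * (2 + cB) * Z ^ 105 * ((Z ^ 5)⁻¹ * Z ^ 5) := by rw [hZ5, mul_one]
        _ = (Z ^ 5)⁻¹ / 3670016 * (64 * 3670016 * (2 + cB) * Z ^ 110) := by ring
    rw [h1]
    calc (Z ^ 5)⁻¹ / 3670016 * (64 * 3670016 * (2 + cB) * Z ^ 110)
        ≤ (Z ^ 5)⁻¹ / 3670016 * Real.sinh (θ₁ ^ 2 / 1200 * Real.sqrt Λ) :=
          mul_le_mul_of_nonneg_left hsinh (by positivity)
      _ ≤ k ^ 2 * Real.exp (4 * rp * k / 5) := mul_le_mul hcoef hexp hsinh0 (sq_nonneg _)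
  exact hl.trans hr

end Cone

end Kerr

end Literature.Geometry.Lorentzian

end
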